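/-
Copyright (c) 2026 the pub-hodgecm-mathlib formalisation cell (harness21).  Prover seat hodgecm-mathlib-A-p19 (g19), topic T5 = P8
«(C♯)hol interior», node Cc (3′) brick β-I, NEGATIVE sign (desk F0P2-plan (g8) «=» 21:36:48Z; architecture 21:51:53Z).  KERNEL: theorems only.
-/
import Literature.NumberTheory.GelbartRogawski1991.DoubledWeilRepresentationArchPlacePhase
import HarnessLib

/-!
# The phase map of Folland's section at the one-place element `k_{v₀,u}`, pair form NEGATIVE at `v₀`:
# `placeBlock (δ_{v₀} ↦ (W_u ⊕ 1)^{e₂})` with `W_u` the scaled-frame matrix of `u ⊗ 1_W` itself (no conjugate)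
# ([Folland1989, Prop. (4.39)]; [Weil1964, Chap. III n° 37]; [KonnoKonno2007, §3.1, Lem. 5.2])

Topic `NumberTheory/GelbartRogawski1991` (T5 = P8 «(C♯)hol interior», node Cc (3′), brick β-I, negative sign); namespace
`Literature.NumberTheory.GelbartRogawski1991.GRConstruction`.  KERNEL ONLY: proved theorems; 0 definitions, 0 records, 0 `sorry`.
Mirror of ★ `DoubledWeilRepresentationArchPlacePhase` §3 (`…_of_pos`): when the pair form `diag dV ⊗ diag dW` is NEGATIVE at the real place `v₀`,
the first copy of the doubled space is the NEGATIVE sign block of the Folland frame at `v₀` (and the second copy the positive one), so the block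
unitary of ★ `coe_dualPairι` moves the first copy by the scaled-frame matrix `W_u = D (e-reindex (u ⊗ 1_W)) D⁻¹` WITHOUT conjugation
(`exists_proj_sectionD_archKPlace_eq_placeBlock_of_neg`), and `sectionD k_{v₀,u}` acts by `vac • μ₀(placeBlock (Pi.mulSingle v₀ ((W_u ⊕ 1)^{e₂⁻¹})))`
(`exists_sectionD_archKPlace_apply_of_neg`; here `vac = ((det u)^M)⁻¹`, ★ `vac_sectionD_archKPlace_of_neg`, kept symbolic).  Together with the positive
case this is the input of brick β-II / ★ T2 `omega_chiSplitting_placePair_tmul_of_box` at every definite place.  §2 (sub-brick S2 of the Cc (3′)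
closer road): the determinant of `W` at both signs (`det_eq_star_pow_of_entries`, `det_eq_pow_of_entries`) and `conj (det u) · det u = 1` on
`archLocal` (`star_det_mul_det_eq_one_of_mem_archLocal`) — so the scalar `((det u)^M)^{(τ_w ± 1)/2}` of ★ (G) is `(det W)^{∓(τ_w ± 1)/2}`.

HONEST SCOPE.  Statements about the tree's own Weil-representation terms; nothing of [Liu2021] is asserted; HC_CM is NOT proved here or anywhere
in the tree.

References: [Folland1989] §4.2 Prop. (4.39); [Weil1964] Chap. III n° 37; [KonnoKonno2007] §3.1 (3.1), Lemma 5.2 p. 73; [BorelJacquet1979] §4.1.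
-/

set_option autoImplicit false

noncomputable section

open scoped Matrix Kronecker

namespace Literature.NumberTheory.GelbartRogawski1991.GRConstruction

open scoped Classical TensorProduct SchwartzMap
open NumberField NumberField.InfinitePlace NumberField.mixedEmbedding IsDedekindDomain
open Literature.RepresentationTheory.HeisenbergGroup
open Literature.NumberTheory.Automorphic Literature.NumberTheory.Automorphic.UnitaryGroup
open Literature.NumberTheory.Weil1964
open Literature.Analysis.SegalBargmann
open Literature.RepresentationTheory.KonnoKonno2007 Literature.RepresentationTheory.KonnoKonno2007.RealDualPair
open UnitaryDualPair UnitaryDualPair.ArchSplitting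
open Literature.NumberTheory.GelbartRogawski1991.UnitaryDualPair.LocalSplitting

variable (L : Type) [Field L] [NumberField L] [IsCMField L]

variable {N M n : ℕ} (e : Fin N × Fin M ≃ Fin n)
  (dV : Fin N → L) (hdV : ∀ i, IsCMField.complexConj L (dV i) = dV i) (hdV0 : ∀ i, dV i ≠ 0)
  (dW : Fin M → L) (hdW : ∀ i, IsCMField.complexConj L (dW i) = dW i) (hdW0 : ∀ i, dW i ≠ 0)
  (v₀ : {v : InfinitePlace (Fp L) // v.IsReal})

set_option maxHeartbeats 1600000 in
-- (entry bookkeeping through `archUFormPi`/`kV`/`signSplit`/`e₂` at every real place; one `simp` per sign case)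
/-- **THE PHASE OF FOLLAND'S SECTION AT `k_{v₀,u}`, pair form NEGATIVE at `v₀`**: there is `W ∈ U(n)` with entries
`W i i′ = D_i · (e-reindex (u ⊗ 1_W))_{i i′} · D_{i′}⁻¹` (NO conjugate: the first copy is now the NEGATIVE sign block) (`D = √|x_{v₀}|`, the scale of `frameV` at `v₀`) such that
`proj (sectionD k_{v₀,u}) = realifySp (placeBlock (Pi.mulSingle v₀ ((W ⊕ 1)^{e₂⁻¹})))` — at `v₀` the first copy moves by the scaled-frame
matrix of `u ⊗ 1_W` itself (★ `coe_dualPairι`: only the positive sign block — here the second copy, on which `k_{v₀,u}` is `1` — is conjugated) and the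
second copy is fixed; every other real place is
fixed (★ `coe_archAt_archKPlace`, ★ `archAt_archSingle_of_ne`). [cite: Folland1989, §4.2 Prop. (4.39)] [cite: KonnoKonno2007, §3.1 (3.1), Lemma 5.2 p. 73]
[cite: BorelJacquet1979, §4.1] -/
theorem exists_proj_sectionD_archKPlace_eq_placeBlock_of_neg (u : UnitaryGroup.archLocal L N (Matrix.diagonal dV) (cmPlaceOver L v₀))
    (hneg : ∀ k : Fin n, ¬ 0 < signVec (cmPlaceOver L) (cmGramEntry L e dV hdV dW hdW) (imagUnit L) v₀ k) :
    ∃ W : Matrix.unitaryGroup (Fin n) ℂ,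
      (∀ i i' : Fin n, (W : Matrix (Fin n) (Fin n) ℂ) i i' =
        (((sqrtAbs (signVec (cmPlaceOver L) (cmGramEntry L e dV hdV dW hdW) (imagUnit L) v₀) i : ℝ) : ℂ)) *
          Matrix.reindex e e
            ((((u : UnitaryGroup.archLocal L N (Matrix.diagonal dV) (cmPlaceOver L v₀)) : GL (Fin N) ℂ) : Matrix (Fin N) (Fin N) ℂ) ⊗ₖ
              (1 : Matrix (Fin M) (Fin M) ℂ)) i i' *
          (((sqrtAbs (signVec (cmPlaceOver L) (cmGramEntry L e dV hdV dW hdW) (imagUnit L) v₀) i' : ℝ) : ℂ))⁻¹) ∧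
      MpS.proj (sectionD L e dV hdV hdV0 dW hdW hdW0 (archKPlace L e dV hdV dW hdW v₀ u)) =
        realifySp _ (placeBlock (Pi.mulSingle v₀ (reindexUnitary (e₂ (n := n)).symm (blockU (W, 1))))) := by
  have hdef : ∀ k k' : Fin n, (0 < signVec (cmPlaceOver L) (cmGramEntry L e dV hdV dW hdW) (imagUnit L) v₀ k ↔
      0 < signVec (cmPlaceOver L) (cmGramEntry L e dV hdV dW hdW) (imagUnit L) v₀ k') :=
    fun k k' => ⟨fun h => absurd h (hneg k), fun h => absurd h (hneg k')⟩
  have hlt : ∀ k : Fin n, signVec (cmPlaceOver L) (cmGramEntry L e dV hdV dW hdW) (imagUnit L) v₀ k < 0 := fun k =>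
    lt_of_le_of_ne (not_lt.mp (hneg k)) (signVec_ne_zero (IsCMField.complexConj_ne_one L) (cmPlaceOver_smul L)
      (complexConj_imagUnit L) (imagUnit_ne_zero L) (cmGramEntry_ne_zero L e dV hdV dW hdW hdV0 hdW0) v₀ k)
  choose k hk using exists_archUFormPi_archKPlace_eq_kV L e dV hdV hdV0 dW hdW hdW0 v₀ u hdef
  -- the NEGATIVE indices at `v₀` are exactly the first copy: `ψ : Fin n ≃ NegIdx`; the second copy is positive
  have hmem : ∀ a : Fin n, ¬ 0 < signVec (cmPlaceOver L) (entryD L e dV hdV dW hdW) (imagUnit L) v₀ ((e₂ (n := n)) (Sum.inl a)) := fun a => by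
    rw [signVec_doubled_inl]; exact hneg a
  have hpos' : ∀ a : Fin n, 0 < signVec (cmPlaceOver L) (entryD L e dV hdV dW hdW) (imagUnit L) v₀ ((e₂ (n := n)) (Sum.inr a)) := fun a => by
    rw [signVec_doubled_inr, neg_pos]; exact hlt a
  have hsurj : ∀ q : NegIdx (signVec (cmPlaceOver L) (entryD L e dV hdV dW hdW) (imagUnit L) v₀), ∃ a : Fin n, q.1 = (e₂ (n := n)) (Sum.inl a) := by
    rintro ⟨x, hx⟩
    obtain ⟨s, rfl⟩ := (e₂ (n := n)).surjective x
    rcases s with a | a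
    · exact ⟨a, rfl⟩
    · exact absurd (hpos' a) hx
  obtain ⟨ψ, hψ⟩ : ∃ ψ : Fin n ≃ NegIdx (signVec (cmPlaceOver L) (entryD L e dV hdV dW hdW) (imagUnit L) v₀),
      ∀ a, (ψ a).1 = (e₂ (n := n)) (Sum.inl a) :=
    ⟨Equiv.ofBijective (fun a => (⟨(e₂ (n := n)) (Sum.inl a), hmem a⟩ : NegIdx (signVec (cmPlaceOver L) (entryD L e dV hdV dW hdW) (imagUnit L) v₀)))
      ⟨fun a a' h => Sum.inl_injective ((e₂ (n := n)).injective (congrArg Subtype.val h)),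
        fun q => by obtain ⟨a, ha⟩ := hsurj q; exact ⟨a, Subtype.ext ha.symm⟩⟩, fun a => rfl⟩
  -- the sign-frame component at `v` in coordinates: `(fromBlocks k₁ 0 0 k₂) (ε x) (ε y) = D_x · (k_{v₀,u})_{w(v)} x y · D_y⁻¹`
  have hent : ∀ (v : {v : InfinitePlace (Fp L) // v.IsReal}) (x y : Fin (n + n)),
      Matrix.fromBlocks ((k v).1 : Matrix _ _ ℂ) 0 0 ((k v).2 : Matrix _ _ ℂ)
          (signSplit (signVec (cmPlaceOver L) (entryD L e dV hdV dW hdW) (imagUnit L) v) x)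
          (signSplit (signVec (cmPlaceOver L) (entryD L e dV hdV dW hdW) (imagUnit L) v) y) =
        (((sqrtAbs (signVec (cmPlaceOver L) (entryD L e dV hdV dW hdW) (imagUnit L) v) x : ℝ) : ℂ)) *
          (((UnitaryGroup.archAt (Fp L) L (IsCMField.complexConj L) (n + n) (hermD L e dV hdV dW hdW) (cmPlaceOver L v) (cmPlaceOver_smul L v)
              (IsCMField.complexConj_ne_one L) (archKPlace L e dV hdV dW hdW v₀ u) :
              UnitaryGroup.archLocal L (n + n) (hermD L e dV hdV dW hdW) (cmPlaceOver L v)) : GL (Fin (n + n)) ℂ) : Matrix (Fin (n + n)) (Fin (n + n)) ℂ) x y *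
          ((((sqrtAbs (signVec (cmPlaceOver L) (entryD L e dV hdV dW hdW) (imagUnit L) v) y : ℝ) : ℂ))⁻¹) := fun v x y => by
    have h := congrArg (fun g : UForm (PosIdx (signVec (cmPlaceOver L) (entryD L e dV hdV dW hdW) (imagUnit L) v))
        (NegIdx (signVec (cmPlaceOver L) (entryD L e dV hdV dW hdW) (imagUnit L) v)) =>
          ((g : GL (PosIdx (signVec (cmPlaceOver L) (entryD L e dV hdV dW hdW) (imagUnit L) v) ⊕
              NegIdx (signVec (cmPlaceOver L) (entryD L e dV hdV dW hdW) (imagUnit L) v)) ℂ) :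
            Matrix (PosIdx (signVec (cmPlaceOver L) (entryD L e dV hdV dW hdW) (imagUnit L) v) ⊕
                NegIdx (signVec (cmPlaceOver L) (entryD L e dV hdV dW hdW) (imagUnit L) v))
              (PosIdx (signVec (cmPlaceOver L) (entryD L e dV hdV dW hdW) (imagUnit L) v) ⊕
                NegIdx (signVec (cmPlaceOver L) (entryD L e dV hdV dW hdW) (imagUnit L) v)) ℂ)
          (signSplit (signVec (cmPlaceOver L) (entryD L e dV hdV dW hdW) (imagUnit L) v) x)
          (signSplit (signVec (cmPlaceOver L) (entryD L e dV hdV dW hdW) (imagUnit L) v) y)) (hk v)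
    simp only [UForm.coe_kV, archUFormPi_apply, coe_archUForm, archPart_archToAdelic, Matrix.reindex_apply, Matrix.submatrix_apply,
      Equiv.symm_apply_apply, scaleConj_apply] at h
    exact h.symm
  -- `D ≠ 0`
  have hD0 : ∀ (v : {v : InfinitePlace (Fp L) // v.IsReal}) (x : Fin (n + n)),
      (((sqrtAbs (signVec (cmPlaceOver L) (entryD L e dV hdV dW hdW) (imagUnit L) v) x : ℝ) : ℂ)) ≠ 0 := fun v x =>
    Complex.ofReal_ne_zero.mpr (sqrtAbs_signVec_ne_zero (IsCMField.complexConj_ne_one L) (cmPlaceOver_smul L)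
      (complexConj_imagUnit L) (imagUnit_ne_zero L) (gramD_gram_realDiagonal_entry_ne_zero L e dV hdV dW hdW hdV0 hdW0) v x)
  -- `ε (e₂ (inl i)) = inr (ψ i)`, `ε (e₂ (inr j)) = inl ⟨_, _⟩` at `v₀`
  have hεl : ∀ i : Fin n, signSplit (signVec (cmPlaceOver L) (entryD L e dV hdV dW hdW) (imagUnit L) v₀) ((e₂ (n := n)) (Sum.inl i)) = Sum.inr (ψ i) :=
    fun i => by
    rw [show ψ i = ⟨(e₂ (n := n)) (Sum.inl i), hmem i⟩ from Subtype.ext (hψ i)]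
    exact Equiv.sumCompl_symm_apply_of_neg (p := fun j => 0 < signVec (cmPlaceOver L) (entryD L e dV hdV dW hdW) (imagUnit L) v₀ j)
      (a := (e₂ (n := n)) (Sum.inl i)) (hmem i)
  have hεr : ∀ j : Fin n, signSplit (signVec (cmPlaceOver L) (entryD L e dV hdV dW hdW) (imagUnit L) v₀) ((e₂ (n := n)) (Sum.inr j)) =
      Sum.inl ⟨(e₂ (n := n)) (Sum.inr j), hpos' j⟩ := fun j =>
    Equiv.sumCompl_symm_apply_of_pos (p := fun j => 0 < signVec (cmPlaceOver L) (entryD L e dV hdV dW hdW) (imagUnit L) v₀ j)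
      (a := (e₂ (n := n)) (Sum.inr j)) (hpos' j)
  refine ⟨reindexUnitary ψ (k v₀).2, fun i i' => ?_, ?_⟩
  · -- the entries of `W`
    have h := hent v₀ ((e₂ (n := n)) (Sum.inl i)) ((e₂ (n := n)) (Sum.inl i'))
    rw [hεl, hεl, Matrix.fromBlocks_apply₂₂, coe_archAt_archKPlace, Matrix.reindex_apply, Matrix.submatrix_apply, Equiv.symm_apply_apply,
      Equiv.symm_apply_apply, Matrix.fromBlocks_apply₁₁] at h
    erw [UnitaryGroup.archAt_archSingle_self (Fp L) L (IsCMField.complexConj L) N (Matrix.diagonal dV) (IsCMField.complexConj_ne_one L)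
      (complexConj_smul_infinitePlace L) (cmPlaceOver L v₀) u] at h
    rw [reindexUnitary_apply, h]
    simp only [sqrtAbs, signVec_doubled_inl]
  · -- the phase map
    rw [show MpS.proj (sectionD L e dV hdV hdV0 dW hdW hdW0 (archKPlace L e dV hdV dW hdW v₀ u)) = _ from
      proj_archWeilSectionS_eq_realifySp_placeBlock L (IsCMField.complexConj L) (n + n) (IsCMField.complexConj_ne_one L) (cmPlaceOver L)
        (cmPlaceOver_smul L) (cmPlaceOver_comap L) (entryD L e dV hdV dW hdW)
        (gramD_gram_realDiagonal_entry_ne_zero L e dV hdV dW hdW hdV0 hdW0) (gramD_eq_diagonal_cm L e dV hdV dW hdW)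
        (J := hermD L e dV hdV dW hdW) rfl (complexConj_imagUnit L) (imagUnit_ne_zero L) (archKPlace L e dV hdV dW hdW v₀ u)
        (fun v => (k v).1) (fun v => (k v).2) (fun v => by rw [Prod.mk.eta]; exact hk v)]
    refine congrArg _ (congrArg placeBlock (funext fun v => ?_))
    by_cases hv : v = v₀
    · subst hv
      rw [Pi.mulSingle_eq_same]
      apply Subtype.ext
      refine Matrix.ext fun x y => ?_
      obtain ⟨s, rfl⟩ := (e₂ (n := n)).surjective x
      obtain ⟨t, rfl⟩ := (e₂ (n := n)).surjective y
      rw [reindexUnitary_apply, reindexUnitary_apply, coe_blockU, coe_blockU, coe_conjU, Equiv.symm_apply_apply, Equiv.symm_apply_apply]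
      rcases s with i | j <;> rcases t with i' | j'
      · rw [hεl, hεl, Matrix.fromBlocks_apply₂₂, Matrix.fromBlocks_apply₁₁, reindexUnitary_apply]
      · rw [hεl, hεr, Matrix.fromBlocks_apply₂₁, Matrix.fromBlocks_apply₁₂, Matrix.zero_apply, Matrix.zero_apply]
      · rw [hεr, hεl, Matrix.fromBlocks_apply₁₂, Matrix.fromBlocks_apply₂₁, Matrix.zero_apply, Matrix.zero_apply]
      · rw [hεr, hεr, Matrix.fromBlocks_apply₁₁, Matrix.fromBlocks_apply₂₂, Matrix.map_apply]
        have h := hent v ((e₂ (n := n)) (Sum.inr j)) ((e₂ (n := n)) (Sum.inr j'))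
        rw [hεr, hεr, Matrix.fromBlocks_apply₁₁, coe_archAt_archKPlace, Matrix.reindex_apply, Matrix.submatrix_apply, Equiv.symm_apply_apply,
          Equiv.symm_apply_apply, Matrix.fromBlocks_apply₂₂] at h
        rw [h]
        show _ = ((1 : Matrix.unitaryGroup (Fin n) ℂ) : Matrix (Fin n) (Fin n) ℂ) j j'
        rw [OneMemClass.coe_one]
        by_cases hj : j = j'
        · subst hj
          rw [Matrix.one_apply_eq, mul_one, mul_inv_cancel₀ (hD0 v _), star_one]
        · rw [Matrix.one_apply_ne hj, mul_zero, zero_mul, star_zero]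
    · rw [Pi.mulSingle_eq_of_ne hv]
      -- at `v ≠ v₀` the component is `1`: `(k_{v₀,u})_{w(v)} = 1`
      have hne : cmPlaceOver L v ≠ cmPlaceOver L v₀ := fun h => hv (Subtype.ext (by
        rw [← cmPlaceOver_comap L v, ← cmPlaceOver_comap L v₀, h]))
      have hG : (((UnitaryGroup.archAt (Fp L) L (IsCMField.complexConj L) (n + n) (hermD L e dV hdV dW hdW) (cmPlaceOver L v) (cmPlaceOver_smul L v)
          (IsCMField.complexConj_ne_one L) (archKPlace L e dV hdV dW hdW v₀ u) :
          UnitaryGroup.archLocal L (n + n) (hermD L e dV hdV dW hdW) (cmPlaceOver L v)) : GL (Fin (n + n)) ℂ) : Matrix (Fin (n + n)) (Fin (n + n)) ℂ) = 1 := by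
        rw [coe_archAt_archKPlace]
        erw [UnitaryGroup.archAt_archSingle_of_ne (Fp L) L (IsCMField.complexConj L) N (Matrix.diagonal dV) (IsCMField.complexConj_ne_one L)
          (complexConj_smul_infinitePlace L) (cmPlaceOver L v₀) hne u]
        simp only [OneMemClass.coe_one, Units.val_one, Matrix.one_kronecker_one, Matrix.reindex_apply, Matrix.submatrix_one_equiv,
          Matrix.fromBlocks_one]
      apply Subtype.ext
      refine Matrix.ext fun x y => ?_
      rw [reindexUnitary_apply, coe_blockU, coe_conjU, OneMemClass.coe_one]
      have h := hent v x y
      rw [hG] at h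
      rcases hx : signSplit (signVec (cmPlaceOver L) (entryD L e dV hdV dW hdW) (imagUnit L) v) x with p | q <;>
        rcases hy : signSplit (signVec (cmPlaceOver L) (entryD L e dV hdV dW hdW) (imagUnit L) v) y with p' | q'
      · rw [hx, hy, Matrix.fromBlocks_apply₁₁] at h
        rw [Matrix.fromBlocks_apply₁₁, Matrix.map_apply, h]
        by_cases hxy : x = y
        · subst hxy; rw [Matrix.one_apply_eq, mul_one, mul_inv_cancel₀ (hD0 v _), star_one]
        · rw [Matrix.one_apply_ne hxy, mul_zero, zero_mul, star_zero]
      · have hx' : x = p.1 := ((Equiv.symm_apply_eq _).mp hx).trans (Equiv.sumCompl_apply_inl p)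
        have hy' : y = q'.1 := ((Equiv.symm_apply_eq _).mp hy).trans (Equiv.sumCompl_apply_inr q')
        have hxy : x ≠ y := fun hxy => q'.2 (hy' ▸ hxy ▸ hx' ▸ p.2)
        rw [Matrix.fromBlocks_apply₁₂, Matrix.zero_apply, Matrix.one_apply_ne hxy]
      · have hx' : x = q.1 := ((Equiv.symm_apply_eq _).mp hx).trans (Equiv.sumCompl_apply_inr q)
        have hy' : y = p'.1 := ((Equiv.symm_apply_eq _).mp hy).trans (Equiv.sumCompl_apply_inl p')
        have hxy : x ≠ y := fun hxy => q.2 (hx' ▸ hxy ▸ hy' ▸ p'.2)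
        rw [Matrix.fromBlocks_apply₂₁, Matrix.zero_apply, Matrix.one_apply_ne hxy]
      · rw [hx, hy, Matrix.fromBlocks_apply₂₂] at h
        rw [Matrix.fromBlocks_apply₂₂, h]
        by_cases hxy : x = y
        · subst hxy; rw [Matrix.one_apply_eq, mul_one, mul_inv_cancel₀ (hD0 v _)]
        · rw [Matrix.one_apply_ne hxy, mul_zero, zero_mul]

/-- **THE OPERATOR OF FOLLAND'S SECTION AT `k_{v₀,u}`, pair form NEGATIVE at `v₀`**: with `W` as in
`exists_proj_sectionD_archKPlace_eq_placeBlock_of_neg`, `sectionD k_{v₀,u}` acts on `𝓢(ℝ^{Fin (n+n) × places})` by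
`vac (sectionD k_{v₀,u}) • μ₀(placeBlock (Pi.mulSingle v₀ ((W ⊕ 1)^{e₂⁻¹})))` (★ `MpS.apply_eq_vac_smul_unitaryOpPi`).
[cite: Folland1989, §4.2 Prop. (4.39)] [cite: KonnoKonno2007, Lemma 5.2 p. 73] -/
theorem exists_sectionD_archKPlace_apply_of_neg (u : UnitaryGroup.archLocal L N (Matrix.diagonal dV) (cmPlaceOver L v₀))
    (hneg : ∀ k : Fin n, ¬ 0 < signVec (cmPlaceOver L) (cmGramEntry L e dV hdV dW hdW) (imagUnit L) v₀ k) :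
    ∃ W : Matrix.unitaryGroup (Fin n) ℂ,
      (∀ i i' : Fin n, (W : Matrix (Fin n) (Fin n) ℂ) i i' =
        (((sqrtAbs (signVec (cmPlaceOver L) (cmGramEntry L e dV hdV dW hdW) (imagUnit L) v₀) i : ℝ) : ℂ)) *
          Matrix.reindex e e
            ((((u : UnitaryGroup.archLocal L N (Matrix.diagonal dV) (cmPlaceOver L v₀)) : GL (Fin N) ℂ) : Matrix (Fin N) (Fin N) ℂ) ⊗ₖ
              (1 : Matrix (Fin M) (Fin M) ℂ)) i i' *
          (((sqrtAbs (signVec (cmPlaceOver L) (cmGramEntry L e dV hdV dW hdW) (imagUnit L) v₀) i' : ℝ) : ℂ))⁻¹) ∧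
      ∀ f : SchwartzMap ((Fin (n + n) × {v : InfinitePlace (Fp L) // v.IsReal}) → ℝ) ℂ,
        (sectionD L e dV hdV hdV0 dW hdW hdW0 (archKPlace L e dV hdV dW hdW v₀ u)).1.2 f =
          MpS.vac (sectionD L e dV hdV hdV0 dW hdW hdW0 (archKPlace L e dV hdV dW hdW v₀ u)) •
            unitaryOpPi (placeBlock (Pi.mulSingle v₀ (reindexUnitary (e₂ (n := n)).symm (blockU (W, 1))))) f := by
  obtain ⟨W, hW, hproj⟩ := exists_proj_sectionD_archKPlace_eq_placeBlock_of_neg L e dV hdV hdV0 dW hdW hdW0 v₀ u hneg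
  exact ⟨W, hW, fun f => MpS.apply_eq_vac_smul_unitaryOpPi hproj f⟩

/-! ## §2 The determinant of `W` (both signs): `det W = conj ((det u)^M)` (positive) / `(det u)^M` (negative) — sub-brick S2 -/

section Det

omit [NumberField L] [IsCMField L] in
/-- **`det W = conj (det U)^M`** for a matrix with the entries of the POSITIVE-sign `W` of ★ `exists_proj_sectionD_archKPlace_eq_placeBlock_of_pos`
(`W = conj (D · (U ⊗ 1_M)^e · D⁻¹)` entrywise): conjugation by the real scaling does not change the determinant (`Matrix.det_units_conj` with
★ `scaleGL`), `det ((U ⊗ 1)^e) = (det U)^M` (`Matrix.det_reindex_self`, `Matrix.det_kronecker`), and entrywise `conj` gives `conj` of the determinant.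
[cite: KonnoKonno2007, Lemma 5.2 p. 73] -/
theorem det_eq_star_pow_of_entries (W : Matrix (Fin n) (Fin n) ℂ) {D : Fin n → ℝ} (hD : ∀ i, D i ≠ 0) (U : Matrix (Fin N) (Fin N) ℂ)
    (hW : ∀ i i', W i i' = star ((((D i : ℝ) : ℂ)) * Matrix.reindex e e (U ⊗ₖ (1 : Matrix (Fin M) (Fin M) ℂ)) i i' * ((((D i' : ℝ) : ℂ)))⁻¹)) :
    W.det = star (U.det ^ M) := by
  have h1 : W = (starRingEnd ℂ).mapMatrix (scaleConj D (Matrix.reindex e e (U ⊗ₖ (1 : Matrix (Fin M) (Fin M) ℂ)))) := by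
    ext i i'
    rw [hW, RingHom.mapMatrix_apply, Matrix.map_apply, scaleConj_apply, starRingEnd_apply]
  rw [h1, ← RingHom.map_det, starRingEnd_apply, ← scaleGL_mul_mul_inv D hD, Matrix.det_units_conj, Matrix.det_reindex_self,
    Matrix.det_kronecker, Matrix.det_one, one_pow, mul_one, Fintype.card_fin]

omit [NumberField L] [IsCMField L] in
/-- **`det W = (det U)^M`** for a matrix with the entries of the NEGATIVE-sign `W` of `exists_proj_sectionD_archKPlace_eq_placeBlock_of_neg`
(`W = D · (U ⊗ 1_M)^e · D⁻¹` entrywise). [cite: KonnoKonno2007, Lemma 5.2 p. 73] -/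
theorem det_eq_pow_of_entries (W : Matrix (Fin n) (Fin n) ℂ) {D : Fin n → ℝ} (hD : ∀ i, D i ≠ 0) (U : Matrix (Fin N) (Fin N) ℂ)
    (hW : ∀ i i', W i i' = (((D i : ℝ) : ℂ)) * Matrix.reindex e e (U ⊗ₖ (1 : Matrix (Fin M) (Fin M) ℂ)) i i' * ((((D i' : ℝ) : ℂ)))⁻¹) :
    W.det = U.det ^ M := by
  have h1 : W = scaleConj D (Matrix.reindex e e (U ⊗ₖ (1 : Matrix (Fin M) (Fin M) ℂ))) := by
    ext i i'
    rw [hW, scaleConj_apply]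
  rw [h1, ← scaleGL_mul_mul_inv D hD, Matrix.det_units_conj, Matrix.det_reindex_self, Matrix.det_kronecker, Matrix.det_one, one_pow, mul_one,
    Fintype.card_fin]

omit [NumberField L] [IsCMField L] in
include hdV0 in
/-- **`|det u| = 1` on the archimedean local unitary group of a diagonal form with non-zero entries** (`ūᵀ J u = J`, `det J ≠ 0` ⇒
`conj (det u) · det u = 1`). [cite: PlatonovRapinchuk1994, §2.3] -/
theorem star_det_mul_det_eq_one_of_mem_archLocal (w : {w : InfinitePlace L // w.IsComplex})
    (u : UnitaryGroup.archLocal L N (Matrix.diagonal dV) w) :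
    star (((u : UnitaryGroup.archLocal L N (Matrix.diagonal dV) w) : GL (Fin N) ℂ) : Matrix (Fin N) (Fin N) ℂ).det *
        (((u : UnitaryGroup.archLocal L N (Matrix.diagonal dV) w) : GL (Fin N) ℂ) : Matrix (Fin N) (Fin N) ℂ).det = 1 := by
  have hmem := (UnitaryGroup.mem_archLocal_iff L N (Matrix.diagonal dV) w ((u : UnitaryGroup.archLocal L N (Matrix.diagonal dV) w) : GL (Fin N) ℂ)).1 u.2
  have hdet := congrArg Matrix.det hmem
  rw [Matrix.det_mul, Matrix.det_mul, Matrix.det_transpose, ← RingHom.mapMatrix_apply, ← RingHom.map_det, starRingEnd_apply] at hdet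
  have hJ : ((Matrix.diagonal dV).map w.1.embedding).det ≠ 0 := by
    rw [Matrix.diagonal_map (map_zero _), Matrix.det_diagonal]
    exact Finset.prod_ne_zero_iff.2 fun i _ => (map_ne_zero _).2 (hdV0 i)
  -- `conj(det u) · det J · det u = det J`
  have h2 : star ((((u : UnitaryGroup.archLocal L N (Matrix.diagonal dV) w) : GL (Fin N) ℂ) : Matrix (Fin N) (Fin N) ℂ).det) *
      (((u : UnitaryGroup.archLocal L N (Matrix.diagonal dV) w) : GL (Fin N) ℂ) : Matrix (Fin N) (Fin N) ℂ).det *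
      ((Matrix.diagonal dV).map w.1.embedding).det = 1 * ((Matrix.diagonal dV).map w.1.embedding).det := by
    rw [one_mul, mul_right_comm]; exact hdet
  exact mul_right_cancel₀ hJ h2

end Det

end Literature.NumberTheory.GelbartRogawski1991.GRConstruction

end
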